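import Summits.HodgeConjecture.HodgeConjecture.Theorems.F0P3cDyRamFourFrameSocketDefs   -- ★ DEFS LEAF №2a «SOCKET» (dealer LH4-plan (g10); filed by LH4-p03): `RankTransferWild`, `AnchorRowsWild` (+ ★ `localTransferAtOne_of_populations` via its imports)
import HarnessLib

/-!
# Crux `H413`, line LH4 «(D-RAM) FOUR-FRAME» road, STAGE 1a — THE SOCKET GLUE (GATE 1a-1 §5, ★-grade): `AnchorRowsWild M → RankTransferWild M`
# (★ tree twin of `F0/P3a/F0P3a-p01/g30/LAWSOCKET-DRAM-FourFrame.v1_1.F0P3ap01g30.lean` 0287a5bf94bf4ddd §5 `rankTransferWild_of_anchorRows`; deal g10-#6)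

Cell `hodgecm-mathlib` (D-0151), FLOOR 0, crux item H413 = `stmt-HodgeConjecture-24833`, route of record `HCCMUnconditional`; squad F0∕P3c∕LH4 (req618), dealer LH4-plan
(g10) WORD #2 (R2-4) deal g10-#6; heir LEAD F0P3a-plan DIRECTIVE b9ecbbedecc9c5ae; author of the HOME proof F0P3a-p01 (g30), port LH4-p03 (g11).  THEOREMS ONLY (one theorem;
no `def`, no instance, no notation, no named-fact hypothesis beyond the stated antecedent, no `sorry`, default heartbeats); imports = ★ SOCKET-DEFS leaf
`Theorems/F0P3cDyRamFourFrameSocketDefs.lean` (deal g10-#0b №2a: the Props `AnchorRowsWild`, `RankTransferWild` BY NAME) + HarnessLib; lane `--supports stmt-HodgeConjecture-24833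
--as helper` (count-neutral).

WHAT IS PROVED.  `rankTransferWild_of_anchorRows (M) : AnchorRowsWild M → RankTransferWild M` — at every wild ramified non-split place `v` of `L⁺` and every unipotent datum
`(S, mU)` with the Rao clause, the ROWS input (reference pieces `g_u` of `ϖ_w`-adic level `M(w)`, invertible unipotent table, and for every unitary `μ` of the letter and all
canonical families ONE finite smooth `H`-family per piece realising its three POPULATION ROWS — type (1) ∕ type (2) ∕ Levi, the clause shapes of ★
`localTransferAtOne_of_populations` verbatim) yields the socket's FUSED input `RankTransferWild M` of the cert of record v1.1 94d1d696bbaaed50 (same pieces and table, and a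
local `Δ‴_v[μ]`-transfer at the identity for EACH piece).  PROOF (p01 (g30), 8 lines, carried verbatim): destructure, keep pieces∕table, and per piece fold the three rows by ★
`Literature.NumberTheory.Rogawski1990.localTransferAtOne_of_populations` (admissibility of `mH` from ★ `IsCanonical.isAdmissibleOn`).  With the cert's top joint
`dyRamCore_of_fourFrame (M) (h : RankTransferWild M) : ‹stub_DyRamCore›` this is the sorry-free spine `AnchorRowsWild Mstar → RankTransferWild Mstar → organ` of the sibling line
`Cruxes/H413/Lines/F0_P3c_DyRamFourFrame.lean` (dealer's design word; registration BY WRITE only, s1809 (3)).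

HONEST LABEL.  Count-neutral: the antecedent `AnchorRowsWild M` is the STAGE-1 typing debt (3 × |S| population rows per place; SIGSHEET v2 c03c627160493264 has a law for the
type-(1) rows of the two anchors only — GATE 1a-1 REPORT coverage table); the verdict of record for (D-RAM) stays PRINT [LanglandsShelstad1989 Thm. p. 484 ∕ Rogawski1990
Prop. 4.9.1 (a)] ∕ XL; `HC_CM` is proved only modulo the 7 printed citations (2 remaining: hLiu418 = `stmt-HodgeConjecture-24832`, h413 = `stmt-HodgeConjecture-24833`) until
rung 0 closes.

## References
* [Rogawski1990] J. D. Rogawski, *Automorphic Representations of Unitary Groups in Three Variables*, Ann. of Math. Stud. 123 (1990): §4.9 Prop. 4.9.1 (a) p. 55 (local transfer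
  at the identity), §8.1 (germ expansions).
* [LanglandsShelstad1989] R. P. Langlands, D. Shelstad, *Orbital integrals on forms of SL(3), II*, Canad. J. Math. 41 (1989) 480–507: Theorem (end of §2) p. 484.
-/



noncomputable section

namespace Summit.HodgeConjecture.HodgeConjecture.Cruxes.H413.F0P3cDyRamRankTransferWildOfAnchorRows

open MeasureTheory Measure NumberField IsDedekindDomain Topology Filter
open Literature.NumberTheory.Automorphic Literature.NumberTheory.Automorphic.UnitaryGroup Literature.NumberTheory.Automorphic.IntegralReduction
open Literature.NumberTheory.Rogawski1990 Literature.NumberTheory.GaloisRepresentations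
open Literature.MeasureTheory.Group (descConj)
open scoped Matrix MatrixGroups Classical ValuativeRel WithZero
open Summit.HodgeConjecture.HodgeConjecture.Cruxes.H413.F0P3cDyRamFourFrameSocketDefs

/-- **§5 · `rankTransferWild_of_anchorRows` (PROVED): rows ⇒ the socket's input.**  Each piece's three rows are folded into its local `Δ‴_v[μ]`-transfer at the identity by
★ `localTransferAtOne_of_populations` (admissibility of `mH` from ★ `IsCanonical.isAdmissibleOn`); everything else is carried over. -/
theorem rankTransferWild_of_anchorRows (M : ∀ (L : Type) [Field L] [NumberField L] [IsCMField L] (v : HeightOneSpectrum (𝓞 ↥(maximalRealSubfield L))), UnitaryGroup.PlacesOver L v → ℕ) (h : AnchorRowsWild M) : RankTransferWild M := by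
  intro L _ _ _ v w hw he h2 ϖ hϖ _ _ _ _ S hS mU hmU hRao
  obtain ⟨gref, hgs, hgK, hginv, hgM, htab, hrows⟩ := h L w hw he h2 ϖ hϖ S hS mU hmU hRao
  refine ⟨gref, hgs, hgK, hginv, hgM, htab, ?_⟩
  intro μ hμu hμω _ _ _ _ νH _ _ νG₃ _ _ mH mG₃ hmH hmG i
  obtain ⟨r, ψ, hψ, a, h₁, h₂, h₃⟩ := hrows μ hμu hμω νH νG₃ hmH hmG i
  exact localTransferAtOne_of_populations L (Matrix.of fun i j : Fin 3 => if i.val + j.val + 1 = 3 then (1 : L) else 0) v w hmH.isAdmissibleOn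
    ((finExplicitCollection L (Matrix.of fun i j : Fin 3 => if i.val + j.val + 1 = 3 then (1 : L) else 0) μ (finExplicitDelta_conj_left_all L (Matrix.of fun i j : Fin 3 => if i.val + j.val + 1 = 3 then (1 : L) else 0) μ) (finExplicitDelta_conj_right_all L (Matrix.of fun i j : Fin 3 => if i.val + j.val + 1 = 3 then (1 : L) else 0) μ)) v)
    mG₃ (gref i) ψ hψ a h₁ h₂ h₃

end Summit.HodgeConjecture.HodgeConjecture.Cruxes.H413.F0P3cDyRamRankTransferWildOfAnchorRows

end
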